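import Literature.MathematicalPhysics.QuantumFieldTheory.Balaban1983to89.B7Prop5GeneralLinear

/-!
# B7 Proposition 5 at a general background — file 3: the induction (149)–(155) for the functional derivative of the
# remainders `C_j(U₀, ·)` = `logCovIter − linCovIter`, PER BOND, over the one-step inputs (139), (148), locality as
# hypotheses; (157) and (156) k-uniform (`B7Prop5GeneralInduction`)

CITATION HEADER (lean-in-tree rule 2026-08-18).  Audit cell `pub-balaban`, sub-cell `t4`, NE7c ROUND-2 crew seat
`b2b-balaban-t4-ne7c-formalise-leaf-10` gen 10; owner table `t4/b2b-balaban-t4-ne7c-p1/LEAVES-NE7c-P1.md` row **S68 (c)**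
«[B7] Prop. 5 at a general regular background — the k-fold composition».  Source: T. Bałaban, *Averaging operations for
lattice gauge theories*, Commun. Math. Phys. **98**, 17–51 (1985) [Balaban1985Averaging] (cell paper B7; journal page =
PDF page + 16), Sect. D pp. 40–42 [PDF 24–26], renders `…/1985-cmp98-averaging-p024-x2.png`, `-p025-x2.png`, `-p026-x2.png`
(READ AS IMAGES by this seat 2026-08-20, p. 41/42 through the verbatim transcript carried in `B7Prop5Flat`'s header, same
archive).  Companions REUSED BY NAME: `B7Prop5GeneralLinear` (this seat: (143)/(147) per bond, `linQcov_local`,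
`hasDerivAt_linQcov_family`, `hasDerivAt_linCovIter_line`, `linQcov_sub'`), `B7Prop5GeneralOperators`/`…OperatorFacts`
(`kerQ`, `kerQdd`, `avQ`, `ddQ`, `Qpp_restr_eq_ddQ`, «QQ″_j ≦ (2−L⁻¹)Q″_{j+1}», «Q″Q_j ≦ Q″_{j+1}», (142)), `B7Prop4GeneralLevels`
(`logCovIter`, `linCovIter`), `B7Prop3GeneralLinear` (`Qcov = linQcov + Ccov`), `B7Ineq148` (pv23: `Ineq148Printed` = the
shape of (148), `dPair_eq_fderiv`), `B7Prop5Flat` (b07: `bump`, `S1`, `restr`, `agreeOn_insCfg_restr`; the flat case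
`prop5_flat_induction` is the template of the present proof), `B7Prop3Flat` (`insCfg`).

THE PRINTED TEXT (pp. 40–42, verbatim): «Now we will generalize it to the whole function Q_k. It is enough to prove it for
C_k. For one-step renormalization transformation we have the bound |⟨δC(V₀, A)/δA, δA⟩| ≦ C″₁|A|Q″|δA| (148) following easily
from general properties of the function C(V₀, A). The constant C″₁ depends on d and L. We will prove that a similar bound
holds for the functional derivative of C_j(U₀, A) for arbitrary j ≦ k. We will prove by induction that |⟨(δ/δA)C_j(U₀, A),
δA⟩| ≦ C₃|A|Q″_j|δA|, (149) where the configurations A are considered on L^{−j}-lattice and C₃ is a positive constant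
satisfying conditions which will be written later. … C_{j+1}(U₀, A) = LQ(Ū₀ʲ)C_j(U₀, L^{−1}A) + C(Ū₀ʲ, L^{−1}Q_j(U₀)A +
C_j(U₀, L^{−1}A)), (152) … Differentiation of the above equality gives ⟨(δ/δA)C_{j+1}(U₀, A), δA⟩ = Q(Ū₀ʲ)⟨(δC_j/δA)(U₀,
L^{−1}A), δA⟩ + ⟨(δC/δA)(Ū₀ʲ, L^{−1}Q_j(U₀)A + C_j(U₀, L^{−1}A)), L^{−1}Q_j(U₀)δA + L^{−1}⟨(δC_j/δA)(U₀, L^{−1}A), δA⟩⟩. (153)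
Using (143), (148), (149) we obtain the following bound: (154) This bound implies the inequality (149) for j + 1 if
4dC′₁α₀L^{−1} + (C″₁/C₃)(1 + 4dC′₁α₀L^{−2} + C₂L^{−1}α₁ + 2dC₃L^{−1}α₁)² ≦ 1. (155) This inequality is satisfied if C₃ > C″₁
and α₀, α₁ are sufficiently small … Thus we have proved Proposition 5. The functional derivative of Q_k(U₀, ηA) is a bounded
function for α₀, α₁ sufficiently small, and we have the bounds |(δ/δA_b)Q_k(U₀, ηA, c)| ≦ 1 + 2C′₁α₀ + C₃|A| < 1 + 2C′₁α₀ +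
C₃α₁, (156) |(δ/δA_b)C_k(U₀, A, c)| ≦ C₃|A| < C₃α₁. (157)»

DICTIONARY (as in `B7Prop5GeneralLinear` and b07's `B7Prop5Flat`; `B = ηA`, every level rescaled to `ℤᵈ`, `s_j = (Lʲη)² =
(Lʲ/Lᵏ)²`, `θ` = print's `2C′₁α₀`).  `C_j(U₀, LʲηA)` of (150) ↦ `CCovIter L U₀ B j = logCovIter − linCovIter`; the differential
(137) in the single-bond direction `X·δ_b` ↦ `dCov L U₀ B (bump y μ X) j c = lineDeriv ℂ (B′ ↦ C_j(B′)(c)) B (X·δ_b)` (`t ∈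
ℂ`); (149)ⱼ per bond ↦ `‖dCov(c)‖ ≤ C₃·((Lʲ)²b)·kerQdd L j c b·‖X‖` (`= C₃|A|·Q″_j|δA|(c)` with `|A| = Lʲb` on the
`L^{−j}`-lattice and `Q″_j(|X|δ_b)(c) = L^{−jd}|X|𝟙[b ⊂ Bʲ(c₋)∪Bʲ(c₊)]`, the second `Lʲ` being the un-normalisation, exactly
b07's `K5`); (148) at `V₀ = Ū₀ʲ` ↦ HYPOTHESIS `h148` (`B7Ineq148.Ineq148Printed` for `a ↦ C(Ū₀ʲ, ins_S a)(c)` on `𝔸^S`,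
`S` = the bonds of `B(c₋) ∪ B(c₊)`, radius `ρ`, constant `C″`) with `hdiff` (differentiability there) and `hloc` (locality
of `C(Ū₀ʲ, ·)(c)`); (139) ↦ `h139`; `|L^{−1}Q_j(U₀)A + C_j| < ½c₃`-type domain condition ↦ `h131` («|Q_j(U₀, ηA)| ≦ 2Lʲηα₁»,
(131)) + `hρ` (`2Lʲb < ρ`); (155) ↦ `h155` in the form the per-bond bookkeeping produces (print's `C₂L^{−1}α₁`-refinement
of the size of the argument replaced by (131)'s factor `2`, as in b07's flat file).

WHAT THIS FILE PROVES (kernel, 0 sorry), for `L ≥ 2`: `CCovIter_succ` = THE RECURSION (152) (from «Q_{j+1} = Q(Ū₀ʲ, Q_j)»,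
`Qcov = linQcov + Ccov`, additivity of the linear part); **`ineq149`** = the (149) induction PER BOND for every `j ≤ k`:
differentiability of `t ↦ C_j(B + tXδ_b)(c)` at `0` and `‖dC_j(B; Xδ_b)(c)‖ ≤ C₃(Lʲ)²b·kerQdd(c, b)·‖X‖` — step = (153):
chain rule through the finitely many variables of `C(Ū₀ʲ, ·, c)` (`hloc`, `hdiff`), (148) (`h148`, pv23's `dPair`), the
column facts «QQ″_j ≦ (2−L⁻¹)Q″_{j+1}», «Q″Q_j ≦ Q″_{j+1}», (142), (143) per bond (`B7Prop5GeneralLinear.ineq143`), and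
the closing arithmetic `ineq155_arith` under `h155`; **`prop5_157`** (uniform form `≤ C₃(Lʲ)²L^{−jd}b‖X‖`, locality «zero
unless b ⊂ Bʲ(c₋) ∪ Bʲ(c₊)»), **`prop5_156`** ((156): the derivative of `Q_j(U₀, ηA)(c)` itself, `≤ ((1 + θs_j)Lʲ +
C₃(Lʲ)²b)·L^{−jd}‖X‖`).  All constants symbolic; `k` enters only through `s_j ≤ L^{−2}` (`j < k`) and `Lʲb ≤ Lᵏb`.
ABSOLUTE-RULE LEDGER: hypotheses = the displayed one-step inputs about the one-step maps at the backgrounds `avgIter L U₀ j`,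
`j < k` (discharged Summits-side from rows S55/S56/S68 (a)(b)); no `def … : Prop`; nothing of the manuscript cited as fact.
HONEST (cell): B7-internal bookkeeping on OUR side of WALL §2 (a) (W-a (Cf′)); NE7c NOT PRINTED, NOT PROVED; spine PROVED
0/9; rung (B)+1 on a FINITE T⁴ — NOT infinite volume, NOT mass gap, NOT Clay.  HONEST DEPENDENCY: continuum YM on T⁴ ⇐
BetaPertH ∧ nine spine estimates (0/9 proved); BetaPertH ⇐ (D1) ∧ (D4) ∧ CAP+tail; G-an2-4 gates asym, D1 and NE2/3/4.
-/

noncomputable section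

open scoped BigOperators
open Finset

namespace Literature.MathematicalPhysics.QuantumFieldTheory.Balaban1983to89.B7Prop5GeneralInduction

open B7Prop1Explicit B7Prop1Local B7Prop2Explicit B7Prop3Flat B7Prop4Flat B7Prop5Flat B7Eq92Concrete
  B7Prop3GeneralLinear B7Prop4GeneralLevels B7Ineq148 B7Prop5GeneralOperators B7Prop5GeneralOperatorFacts
  B7Prop5GeneralLinear

export B7Prop1Explicit (Site)

variable {d : ℕ} {𝔸 : Type*} [NormedRing 𝔸] [NormedAlgebra ℂ 𝔸] [CompleteSpace 𝔸]

/-! ## §1 The remainders `C_j(U₀, ·)` and their differential in a single-bond direction -/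

/-- **`C_j(U₀, LʲηA)` of (150)** «Q_j(U₀, ηA) = LʲηQ_j(U₀)A + C_j(U₀, LʲηA)», in `B`-variables: `C_j = Q_j(U₀, ·) − LʲηQ_j(U₀)·`
(`logCovIter − linCovIter`; at `j = k`, `Lᵏη = 1`, this IS `C_k(U₀, A)` of (134)/(157)). [cite: Balaban1985Averaging, (150) p.40, (134) p.38] -/
def CCovIter (L : ℕ) (U₀ : Site d → Fin d → 𝔸ˣ) (B : Site d → Fin d → 𝔸) (j : ℕ) (z : Site d) (κ : Fin d) : 𝔸 :=
  logCovIter L U₀ B j z κ - linCovIter L U₀ B j z κ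

/-- the differential (137) «dF(A, δA) = (d/dt)F(A + tδA)|_{t=0}» of `B ↦ C_j(B)(c)` in the direction `D` (Mathlib
`lineDeriv ℂ`, `t ∈ ℂ`). [cite: Balaban1985Averaging, (137) p.39] -/
def dCov (L : ℕ) (U₀ : Site d → Fin d → 𝔸ˣ) (B D : Site d → Fin d → 𝔸) (j : ℕ) (z : Site d) (κ : Fin d) : 𝔸 :=
  lineDeriv ℂ (fun B' => CCovIter L U₀ B' j z κ) B D

/-- `C_0 = 0` («Q_0(U₀, ηA) = ηA»). [cite: Balaban1985Averaging, (150) p.40, (127) p.37] -/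
theorem CCovIter_zero (L : ℕ) (U₀ : Site d → Fin d → 𝔸ˣ) (B : Site d → Fin d → 𝔸) (z : Site d) (κ : Fin d) :
    CCovIter L U₀ B 0 z κ = 0 := by
  simp [CCovIter]

/-- **THE RECURSION (152)** «C_{j+1}(U₀, A) = LQ(Ū₀ʲ)C_j(U₀, L^{−1}A) + C(Ū₀ʲ, L^{−1}Q_j(U₀)A + C_j(U₀, L^{−1}A))», in
`B`-variables: `C_{j+1}(c) = C(Ū₀ʲ, Q_j(U₀, ·))(c) + L(Q(Ū₀ʲ)C_j)(c)` — from «Q_{j+1}(U₀, ηA) = Q(Ū₀ʲ, Q_j(U₀, ηA))», the split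
(122) `Q(V₀, ·) = L·Q(V₀)· + C(V₀, ·)` and the additivity of the linear part. [cite: Balaban1985Averaging, (150)–(152) pp.40–41] -/
theorem CCovIter_succ (L : ℕ) (U₀ : Site d → Fin d → 𝔸ˣ) (B : Site d → Fin d → 𝔸) (j : ℕ) (z : Site d) (κ : Fin d)
    (hadd : ∀ F G : Site d → Fin d → 𝔸, linQcov L (avgIter L U₀ j) (F + G) ((L : ℤ) • z) κ =
      linQcov L (avgIter L U₀ j) F ((L : ℤ) • z) κ + linQcov L (avgIter L U₀ j) G ((L : ℤ) • z) κ) :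
    CCovIter L U₀ B (j + 1) z κ = Ccov L (avgIter L U₀ j) (logCovIter L U₀ B j) ((L : ℤ) • z) κ
      + linQcov L (avgIter L U₀ j) (fun x μ' => CCovIter L U₀ B j x μ') ((L : ℤ) • z) κ := by
  have hfun : (fun x μ' => CCovIter L U₀ B j x μ') = logCovIter L U₀ B j - linCovIter L U₀ B j := rfl
  rw [hfun, linQcov_sub' L (avgIter L U₀ j) z κ hadd, CCovIter, logCovIter_succ, linCovIter_succ,
    Qcov_eq_linQcov_add_Ccov]
  abel

/-- `(L^{j+1}/Lᵏ)² = L²·(Lʲ/Lᵏ)²`. [folklore] -/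
private theorem level_sq_succ (L : ℝ) (j k : ℕ) :
    (L ^ (j + 1) * (L ^ k)⁻¹) ^ 2 = L ^ 2 * (L ^ j * (L ^ k)⁻¹) ^ 2 := by
  rw [pow_succ]; ring

/-- `(Lʲ/Lᵏ)² ≤ L^{−2}` for `j < k` («(Lʲη)² ≤ L^{−2}»). [folklore] -/
private theorem level_sq_le {L : ℝ} (hL : 1 ≤ L) {j k : ℕ} (hjk : j < k) :
    (L ^ j * (L ^ k)⁻¹) ^ 2 ≤ L⁻¹ ^ 2 := by
  have hL0 : 0 < L := by linarith
  have hLk : (0 : ℝ) < L ^ k := by positivity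
  have hjk' : L ^ j * L ≤ L ^ k := by rw [← pow_succ]; exact pow_le_pow_right₀ hL hjk
  have hratio : L ^ j * (L ^ k)⁻¹ ≤ L⁻¹ := by
    rw [mul_inv_le_iff₀ hLk, inv_mul_eq_div, le_div_iff₀ hL0]
    exact hjk'
  exact pow_le_pow_left₀ (by positivity) hratio 2

/-- the closing arithmetic replacing (155) in the per-bond bookkeeping: from `h155` (stated with `L^{−1}`-powers and the
largest field size `Lᵏb`), `s ≤ L^{−2}` and `t ≤ Lᵏb`: `(2L − 1) + 2dθsL + (2C″/C₃)(1 + 2dθs + 2dC₃t) ≤ L²` — line 3 → 4 of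
(154) with the sharp `(2 − L^{−1})L^{−1} ≤ 1 − L^{−2}`. [cite: Balaban1985Averaging, (154)–(155) p.41] -/
theorem ineq155_arith {L d θ s C'' C₃ t T : ℝ} (hL : 2 ≤ L) (hd : 0 ≤ d) (hθ : 0 ≤ θ) (hC'' : 0 ≤ C'') (hC₃ : 0 < C₃)
    (hsL : s ≤ L⁻¹ ^ 2) (htT : t ≤ T)
    (h155 : (2 * L - 1) * L⁻¹ ^ 2 + 2 * d * θ * L⁻¹ ^ 3
      + 2 * C'' / C₃ * (1 + 2 * d * θ * L⁻¹ ^ 2 + 2 * d * C₃ * T) * L⁻¹ ^ 2 ≤ 1) :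
    (2 * L - 1) + 2 * d * θ * s * L + 2 * C'' / C₃ * (1 + 2 * d * θ * s + 2 * d * C₃ * t) ≤ L ^ 2 := by
  have hL0 : 0 < L := by linarith
  have hl : L * L⁻¹ = 1 := mul_inv_cancel₀ hL0.ne'
  have hq : 0 ≤ 2 * C'' / C₃ := by positivity
  -- multiply `h155` by `L²`
  have hmul := mul_le_mul_of_nonneg_left h155 (by positivity : (0 : ℝ) ≤ L ^ 2)
  have e1 : L ^ 2 * ((2 * L - 1) * L⁻¹ ^ 2 + 2 * d * θ * L⁻¹ ^ 3
      + 2 * C'' / C₃ * (1 + 2 * d * θ * L⁻¹ ^ 2 + 2 * d * C₃ * T) * L⁻¹ ^ 2)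
      = (2 * L - 1) * (L * L⁻¹) ^ 2 + 2 * d * θ * L⁻¹ * (L * L⁻¹) ^ 2
        + 2 * C'' / C₃ * (1 + 2 * d * θ * L⁻¹ ^ 2 + 2 * d * C₃ * T) * (L * L⁻¹) ^ 2 := by ring
  rw [e1, hl, one_pow, mul_one, mul_one, mul_one, mul_one] at hmul
  -- compare term by term
  have h1 : 2 * d * θ * s * L ≤ 2 * d * θ * L⁻¹ := by
    have := mul_le_mul_of_nonneg_left hsL (by positivity : 0 ≤ 2 * d * θ * L)
    calc 2 * d * θ * s * L = 2 * d * θ * L * s := by ring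
      _ ≤ 2 * d * θ * L * L⁻¹ ^ 2 := this
      _ = 2 * d * θ * L⁻¹ * (L * L⁻¹) := by ring
      _ = 2 * d * θ * L⁻¹ := by rw [hl, mul_one]
  have h2 : 2 * d * θ * s ≤ 2 * d * θ * L⁻¹ ^ 2 := mul_le_mul_of_nonneg_left hsL (by positivity)
  have h3 : 2 * d * C₃ * t ≤ 2 * d * C₃ * T := mul_le_mul_of_nonneg_left htT (by positivity)
  have h4 : 2 * C'' / C₃ * (1 + 2 * d * θ * s + 2 * d * C₃ * t)
      ≤ 2 * C'' / C₃ * (1 + 2 * d * θ * L⁻¹ ^ 2 + 2 * d * C₃ * T) :=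
    mul_le_mul_of_nonneg_left (by linarith) hq
  linarith

/-! ## §2 The (149) induction per bond -/

section Levels

variable (L : ℕ) (hL : 2 ≤ L) (U₀ : Site d → Fin d → 𝔸ˣ) (k : ℕ) {θ C'' C₃ ρ b : ℝ} (hθ : 0 ≤ θ)
  (hC'' : 0 ≤ C'') (hC₃ : 0 < C₃) (hb : 0 ≤ b)
  (hadd : ∀ j < k, ∀ (F G : Site d → Fin d → 𝔸) (z : Site d) (κ : Fin d),
    linQcov L (avgIter L U₀ j) (F + G) ((L : ℤ) • z) κ =
      linQcov L (avgIter L U₀ j) F ((L : ℤ) • z) κ + linQcov L (avgIter L U₀ j) G ((L : ℤ) • z) κ)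
  (hsmul : ∀ j < k, ∀ (t : ℂ) (F : Site d → Fin d → 𝔸) (z : Site d) (κ : Fin d),
    linQcov L (avgIter L U₀ j) (t • F) ((L : ℤ) • z) κ = t • linQcov L (avgIter L U₀ j) F ((L : ℤ) • z) κ)
  (h139 : ∀ j < k, ∀ (G : Site d → Fin d → 𝔸) (z : Site d) (κ : Fin d),
    ‖linQcov L (avgIter L U₀ j) G ((L : ℤ) • z) κ‖ ≤
      avQ L (fun x κ' => ‖G x κ'‖) ((L : ℤ) • z) κ
        + θ * ((L : ℝ) ^ j * ((L : ℝ) ^ k)⁻¹) ^ 2 * (L : ℝ) * ddQ L (fun x κ' => ‖G x κ'‖) ((L : ℤ) • z) κ)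
  (h145 : 8 * d * θ * (L : ℝ)⁻¹ ^ 4 ≤ 1)
  (hloc : ∀ j < k, ∀ (F F' : Site d → Fin d → 𝔸) (z : Site d) (κ : Fin d),
    AgreeOn ((L : ℤ) • z) (bondHi L ((L : ℤ) • z) κ) F F' →
      Ccov L (avgIter L U₀ j) F ((L : ℤ) • z) κ = Ccov L (avgIter L U₀ j) F' ((L : ℤ) • z) κ)
  (h148 : ∀ j < k, ∀ (z : Site d) (κ : Fin d),
    Ineq148Printed (fun a : ↥(S1 L ((L : ℤ) • z) κ) → 𝔸 =>
      Ccov L (avgIter L U₀ j) (insCfg (S1 L ((L : ℤ) • z) κ) a) ((L : ℤ) • z) κ) (L : ℝ) d ρ C'')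
  (hdiff : ∀ j < k, ∀ (z : Site d) (κ : Fin d) (a : ↥(S1 L ((L : ℤ) • z) κ) → 𝔸), ‖a‖ < ρ →
    DifferentiableAt ℂ (fun a : ↥(S1 L ((L : ℤ) • z) κ) → 𝔸 =>
      Ccov L (avgIter L U₀ j) (insCfg (S1 L ((L : ℤ) • z) κ) a) ((L : ℤ) • z) κ) a)
  (B : Site d → Fin d → 𝔸)
  (h131 : ∀ j < k, ∀ (x : Site d) (κ : Fin d), ‖logCovIter L U₀ B j x κ‖ ≤ 2 * ((L : ℝ) ^ j * b))
  (hρ : ∀ j < k, 2 * ((L : ℝ) ^ j * b) < ρ)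
  (h155 : (2 * (L : ℝ) - 1) * (L : ℝ)⁻¹ ^ 2 + 2 * d * θ * (L : ℝ)⁻¹ ^ 3
    + 2 * C'' / C₃ * (1 + 2 * d * θ * (L : ℝ)⁻¹ ^ 2 + 2 * d * C₃ * ((L : ℝ) ^ k * b)) * (L : ℝ)⁻¹ ^ 2 ≤ 1)

include hL hθ hC'' hC₃ hb hadd hsmul h139 h145 hloc h148 hdiff h131 hρ h155 in
/-- **THE (149) INDUCTION, PER BOND, AT A GENERAL BACKGROUND** (pp. 40–41): for the single-bond direction `X·δ_b`,
`b = ⟨y, y + e_μ⟩`, every `j ≤ k` and every bond `c = ⟨z, z + e_κ⟩` of the `j`-th lattice: (a) `t ↦ C_j(B + tXδ_b)(c)` is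
differentiable at `t = 0` ((137), `t ∈ ℂ`); (b) «|⟨(δ/δA)C_j(U₀, A), δA⟩| ≦ C₃|A|Q″_j|δA|» column-wise:
`‖dC_j(B; Xδ_b)(c)‖ ≤ C₃·(Lʲ)²b·kerQdd(c, b)·‖X‖` (so it vanishes unless `b ⊂ Bʲ(c₋) ∪ Bʲ(c₊)`).  Base `j = 0`: `C_0 = 0`.
Step = (153): the chain rule through the variables of `C(Ū₀ʲ, ·, c)` at the point `Q_j(U₀, ηB)|_S` of size `≤ 2Lʲb < ρ`
(`h131`, `hρ`), (148) there (`h148`) against `Q″` of the inner variation `L^{−1}Q_j(U₀)δA + L^{−1}⟨δC_j/δA, δA⟩` bounded by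
(143) per bond and (149)ⱼ through «Q″Q_j ≦ Q″_{j+1}», (142), and the term `Q(Ū₀ʲ)⟨δC_j/δA, δA⟩` by (139) (`h139`) through
«QQ″_j ≦ (2−L⁻¹)Q″_{j+1}», (142); the arithmetic closes by `ineq155_arith` under `h155`.
[cite: Balaban1985Averaging, (149)–(155) pp.40–41] -/
theorem ineq149 (y : Site d) (μ : Fin d) (X : 𝔸) :
    ∀ j ≤ k, ∀ (z : Site d) (κ : Fin d),
      HasLineDerivAt ℂ (fun B' => CCovIter L U₀ B' j z κ) (dCov L U₀ B (bump y μ X) j z κ) B (bump y μ X) ∧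
      ‖dCov L U₀ B (bump y μ X) j z κ‖ ≤ C₃ * (((L : ℝ) ^ j) ^ 2 * b) * kerQdd L j z κ y μ * ‖X‖ := by
  classical
  have hL1 : 1 ≤ L := le_trans (by norm_num) hL
  have hLr : (2 : ℝ) ≤ L := by exact_mod_cast hL
  have hL1r : (1 : ℝ) ≤ L := by linarith
  have hLpos : (0 : ℝ) < L := by linarith
  set D := bump y μ X with hD
  intro j
  induction j with
  | zero =>
    intro _ z κ
    have hd0 : dCov L U₀ B D 0 z κ = 0 := by
      simp [dCov, lineDeriv, CCovIter]
    refine ⟨?_, ?_⟩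
    · rw [hd0]
      show HasDerivAt (fun t : ℂ => CCovIter L U₀ (B + t • D) 0 z κ) 0 0
      simp only [CCovIter_zero]
      exact hasDerivAt_const 0 0
    · rw [hd0, norm_zero]
      have := kerQdd_nonneg L 0 z κ y μ
      positivity
  | succ j ihj =>
    intro hjk z κ
    have hj : j < k := Nat.lt_of_succ_le hjk
    have ih := ihj hj.le
    -- the data of the step
    set q : Site d := (L : ℤ) • z with hq
    set S := S1 L q κ with hS
    set V := avgIter L U₀ j with hV
    set ρ0 : S → 𝔸 := restr S (logCovIter L U₀ B j) with hρ0
    set f : (S → 𝔸) → 𝔸 := fun a => Ccov L V (insCfg S a) q κ with hf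
    set E : Site d → Fin d → 𝔸 := fun x μ' => dCov L U₀ B D j x μ' + linCovIter L U₀ D j x μ' with hE
    set s : ℝ := ((L : ℝ) ^ j * ((L : ℝ) ^ k)⁻¹) ^ 2 with hs
    have hs0 : 0 ≤ s := by positivity
    have hsL : s ≤ (L : ℝ)⁻¹ ^ 2 := level_sq_le hL1r hj
    set K : ℝ := C₃ * (((L : ℝ) ^ j) ^ 2 * b) with hK
    have hK0 : 0 ≤ K := by positivity
    set W := kerQdd L (j + 1) z κ y μ with hW
    have hW0 : 0 ≤ W := kerQdd_nonneg L (j + 1) z κ y μ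
    -- the size of the base point (131) and the domain of (148)
    have htj : 0 ≤ (L : ℝ) ^ j * b := by positivity
    have hρ0n : ‖ρ0‖ ≤ 2 * ((L : ℝ) ^ j * b) :=
      (pi_norm_le_iff_of_nonneg (by positivity)).2 fun s' => h131 j hj _ _
    have hρ0lt : ‖ρ0‖ < ρ := hρ0n.trans_lt (hρ j hj)
    have hfan : DifferentiableAt ℂ f ρ0 := hdiff j hj z κ ρ0 hρ0lt
    -- the line through the variables of `C(Ū₀ʲ, ·, c)`
    have hlog : ∀ x μ', HasDerivAt (fun t : ℂ => logCovIter L U₀ (B + t • D) j x μ') (E x μ') 0 := by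
      intro x μ'
      have h1 : HasDerivAt (fun t : ℂ => CCovIter L U₀ (B + t • D) j x μ') (dCov L U₀ B D j x μ') 0 := (ih x μ').1
      have h2 := hasDerivAt_linCovIter_line L U₀ k hadd hsmul B D hj.le x μ'
      refine (h1.add h2).congr_of_eventuallyEq (Filter.Eventually.of_forall fun t => ?_)
      simp [CCovIter]
    have hρ' : HasDerivAt (fun t : ℂ => restr S (logCovIter L U₀ (B + t • D) j)) (restr S E) 0 :=
      hasDerivAt_pi.2 fun s' => hlog s'.1.1 s'.1.2
    have hρfun0 : restr S (logCovIter L U₀ (B + (0 : ℂ) • D) j) = ρ0 := by rw [zero_smul, add_zero]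
    have hfan0 : DifferentiableAt ℂ f (restr S (logCovIter L U₀ (B + (0 : ℂ) • D) j)) := by rw [hρfun0]; exact hfan
    have hcomp : HasDerivAt (fun t : ℂ => f (restr S (logCovIter L U₀ (B + t • D) j))) (fderiv ℂ f ρ0 (restr S E)) 0 := by
      have := hfan0.hasFDerivAt.comp_hasDerivAt (0 : ℂ) hρ'
      rw [hρfun0] at this
      exact this
    have hone : HasDerivAt (fun t : ℂ => Ccov L V (logCovIter L U₀ (B + t • D) j) q κ) (fderiv ℂ f ρ0 (restr S E)) 0 := by
      refine hcomp.congr_of_eventuallyEq (Filter.Eventually.of_forall fun t => ?_)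
      exact hloc j hj _ _ z κ (agreeOn_insCfg_restr q (bondHi L q κ) _)
    have hlinC : HasDerivAt (fun t : ℂ => linQcov L V (fun x μ' => CCovIter L U₀ (B + t • D) j x μ') q κ)
        (linQcov L V (fun x μ' => dCov L U₀ B D j x μ') q κ) 0 :=
      hasDerivAt_linQcov_family L V z κ (fun F G => hadd j hj F G z κ) (fun t F => hsmul j hj t F z κ)
        (fun G => h139 j hj G z κ) (by positivity) hL1
        (Φ := fun t x μ' => CCovIter L U₀ (B + t • D) j x μ') fun x μ' => (ih x μ').1
    have htot : HasDerivAt (fun t : ℂ => CCovIter L U₀ (B + t • D) (j + 1) z κ)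
        (fderiv ℂ f ρ0 (restr S E) + linQcov L V (fun x μ' => dCov L U₀ B D j x μ') q κ) 0 := by
      refine (hone.add hlinC).congr_of_eventuallyEq (Filter.Eventually.of_forall fun t => ?_)
      exact CCovIter_succ L U₀ _ j z κ fun F G => hadd j hj F G z κ
    have hval : dCov L U₀ B D (j + 1) z κ =
        fderiv ℂ f ρ0 (restr S E) + linQcov L V (fun x μ' => dCov L U₀ B D j x μ') q κ := htot.deriv
    -- sizes of the inner variation: (149)ⱼ and (143)ⱼ per bond
    set C₁ : ℝ := (K + θ * s * (L : ℝ) ^ j) * ‖X‖ with hC₁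
    have hC₁0 : 0 ≤ C₁ := by positivity
    have hdCb : ∀ x μ', ‖dCov L U₀ B D j x μ'‖ ≤ (K * ‖X‖) * kerQdd L j x μ' y μ := fun x μ' => by
      have := (ih x μ').2; rw [hK]; linarith [this]
    have hEb : ∀ x μ', ‖E x μ'‖ ≤ ‖X‖ * kerQ L j x μ' y μ + C₁ * kerQdd L j x μ' y μ := by
      intro x μ'
      have h1 := hdCb x μ'
      have h2 := ineq143 L hL U₀ k hθ h139 h145 y μ X j hj.le x μ'
      calc ‖E x μ'‖ ≤ ‖dCov L U₀ B D j x μ'‖ + ‖linCovIter L U₀ D j x μ'‖ := norm_add_le _ _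
        _ ≤ (K * ‖X‖) * kerQdd L j x μ' y μ
              + (kerQ L j x μ' y μ + θ * s * (L : ℝ) ^ j * kerQdd L j x μ' y μ) * ‖X‖ := add_le_add h1 h2
        _ = ‖X‖ * kerQ L j x μ' y μ + C₁ * kerQdd L j x μ' y μ := by rw [hC₁]; ring
    -- (148) at the base point against `Q″|E|`
    have h148' : ‖fderiv ℂ f ρ0 (restr S E)‖ ≤ C'' * ‖ρ0‖ * ddQ L (fun x μ' => ‖E x μ'‖) q κ := by
      rw [← dPair_eq_fderiv hfan, ← Qpp_restr_eq_ddQ]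
      exact h148 j hj z κ ρ0 hρ0lt (restr S E)
    have hddE : ddQ L (fun x μ' => ‖E x μ'‖) q κ ≤ ‖X‖ * ((L : ℝ) ^ j * W) + C₁ * (2 * d * W) := by
      calc ddQ L (fun x μ' => ‖E x μ'‖) q κ
          ≤ ddQ L (fun x μ' => ‖X‖ * kerQ L j x μ' y μ + C₁ * kerQdd L j x μ' y μ) q κ := ddQ_mono L hEb _ _
        _ = ‖X‖ * ddQ L (fun x μ' => kerQ L j x μ' y μ) q κ + C₁ * ddQ L (fun x μ' => kerQdd L j x μ' y μ) q κ := by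
            rw [ddQ_add, ddQ_smul, ddQ_smul]
        _ ≤ _ := add_le_add (mul_le_mul_of_nonneg_left (ddQ_kerQ_le L hL1 j z κ y μ) (norm_nonneg X))
              (mul_le_mul_of_nonneg_left (ddQ_kerQdd_le L hL1 j z κ y μ) hC₁0)
    have hT2 : ‖fderiv ℂ f ρ0 (restr S E)‖ ≤
        C'' * (2 * ((L : ℝ) ^ j * b)) * (‖X‖ * ((L : ℝ) ^ j * W) + C₁ * (2 * d * W)) := by
      have hdd0 : 0 ≤ ddQ L (fun x μ' => ‖E x μ'‖) q κ := ddQ_nonneg L (fun _ _ => norm_nonneg _) _ _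
      calc ‖fderiv ℂ f ρ0 (restr S E)‖ ≤ C'' * ‖ρ0‖ * ddQ L (fun x μ' => ‖E x μ'‖) q κ := h148'
        _ ≤ C'' * (2 * ((L : ℝ) ^ j * b)) * ddQ L (fun x μ' => ‖E x μ'‖) q κ :=
            mul_le_mul_of_nonneg_right (mul_le_mul_of_nonneg_left hρ0n hC'') hdd0
        _ ≤ _ := mul_le_mul_of_nonneg_left hddE (by positivity)
    -- the term `Q(Ū₀ʲ)⟨δC_j/δA, δA⟩` by (139)
    have hT1 : ‖linQcov L V (fun x μ' => dCov L U₀ B D j x μ') q κ‖ ≤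
        (K * ‖X‖) * ((2 * (L : ℝ) - 1) * W) + θ * s * (L : ℝ) * ((K * ‖X‖) * (2 * d * W)) := by
      have hKX : 0 ≤ K * ‖X‖ := by positivity
      have hav : avQ L (fun x μ' => ‖dCov L U₀ B D j x μ'‖) q κ ≤ (K * ‖X‖) * ((2 * (L : ℝ) - 1) * W) := by
        calc avQ L (fun x μ' => ‖dCov L U₀ B D j x μ'‖) q κ
            ≤ avQ L (fun x μ' => (K * ‖X‖) * kerQdd L j x μ' y μ) q κ := avQ_mono L hdCb _ _
          _ = (K * ‖X‖) * avQ L (fun x μ' => kerQdd L j x μ' y μ) q κ := by rw [avQ_smul]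
          _ ≤ _ := mul_le_mul_of_nonneg_left (avQ_kerQdd_le L hL1 j z κ y μ) hKX
      have hdd : ddQ L (fun x μ' => ‖dCov L U₀ B D j x μ'‖) q κ ≤ (K * ‖X‖) * (2 * d * W) := by
        calc ddQ L (fun x μ' => ‖dCov L U₀ B D j x μ'‖) q κ
            ≤ ddQ L (fun x μ' => (K * ‖X‖) * kerQdd L j x μ' y μ) q κ := ddQ_mono L hdCb _ _
          _ = (K * ‖X‖) * ddQ L (fun x μ' => kerQdd L j x μ' y μ) q κ := by rw [ddQ_smul]
          _ ≤ _ := mul_le_mul_of_nonneg_left (ddQ_kerQdd_le L hL1 j z κ y μ) hKX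
      exact (h139 j hj _ z κ).trans (add_le_add hav (mul_le_mul_of_nonneg_left hdd (by positivity)))
    -- the closing arithmetic (154)–(155)
    have htk : (L : ℝ) ^ j * b ≤ (L : ℝ) ^ k * b :=
      mul_le_mul_of_nonneg_right (pow_le_pow_right₀ hL1r hj.le) hb
    have harith := ineq155_arith (d := (d : ℝ)) hLr (Nat.cast_nonneg d) hθ hC'' hC₃ hsL htk h155
    refine ⟨hval ▸ htot, ?_⟩
    rw [hval]
    refine (norm_add_le _ _).trans ?_
    refine (add_le_add hT2 hT1).trans ?_
    -- everything is `W·‖X‖·(Lʲ)²b·[…]`; compare the bracket with `C₃L²`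
    have hXW : 0 ≤ ‖X‖ * W * (((L : ℝ) ^ j) ^ 2 * b) := by positivity
    have key := mul_le_mul_of_nonneg_left harith (mul_nonneg hXW hC₃.le)
    have hC₃ne : C₃ ≠ 0 := hC₃.ne'
    have expand : C'' * (2 * ((L : ℝ) ^ j * b)) * (‖X‖ * ((L : ℝ) ^ j * W) + C₁ * (2 * d * W))
        + ((K * ‖X‖) * ((2 * (L : ℝ) - 1) * W) + θ * s * (L : ℝ) * ((K * ‖X‖) * (2 * d * W)))
        = ‖X‖ * W * (((L : ℝ) ^ j) ^ 2 * b) * C₃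
          * ((2 * L - 1) + 2 * d * θ * s * L + 2 * C'' / C₃ * (1 + 2 * d * θ * s + 2 * d * C₃ * ((L : ℝ) ^ j * b))) := by
      rw [hC₁, hK]
      field_simp
      ring
    rw [expand]
    refine key.trans (le_of_eq ?_)
    ring

include hL hθ hC'' hC₃ hb hadd hsmul h139 h145 hloc h148 hdiff h131 hρ h155 in
/-- **(157) PER BOND, k-UNIFORM** «|(δ/δA_b)C_k(U₀, A, c)| ≦ C₃|A|»: for every `j ≤ k`, `‖dC_j(B; Xδ_b)(c)‖ ≤ C₃·(Lʲ)²·L^{−jd}·b·‖X‖`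
(at `j = k`, `B = ηA`: `C₃|A|·η^d·‖X‖`, i.e. (157) with (138)'s `η^{−d}`), and the derivative VANISHES unless `b ⊂ Bʲ(c₋) ∪
Bʲ(c₊)` (locality, Prop. 4 p. 38). [cite: Balaban1985Averaging, Prop. 5 (157) p.42, (149) p.40, Prop. 4 p.38] -/
theorem prop5_157 (y : Site d) (μ : Fin d) (X : 𝔸) {j : ℕ} (hj : j ≤ k) (z : Site d) (κ : Fin d) :
    HasLineDerivAt ℂ (fun B' => CCovIter L U₀ B' j z κ) (dCov L U₀ B (bump y μ X) j z κ) B (bump y μ X) ∧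
      ‖dCov L U₀ B (bump y μ X) j z κ‖ ≤ C₃ * ((L : ℝ) ^ j) ^ 2 * (((L : ℝ) ^ j) ^ d)⁻¹ * b * ‖X‖ ∧
      (¬ BondIn (loK L j z) (bondHiK L j z κ) y μ → dCov L U₀ B (bump y μ X) j z κ = 0) := by
  obtain ⟨h1, h2⟩ := ineq149 L hL U₀ k hθ hC'' hC₃ hb hadd hsmul h139 h145 hloc h148 hdiff B h131 hρ h155 y μ X j hj z κ
  refine ⟨h1, h2.trans ?_, fun hnot => ?_⟩
  · have h3 := kerQdd_le L j z κ y μ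
    have : C₃ * (((L : ℝ) ^ j) ^ 2 * b) * kerQdd L j z κ y μ * ‖X‖
        ≤ C₃ * (((L : ℝ) ^ j) ^ 2 * b) * (((L : ℝ) ^ j) ^ d)⁻¹ * ‖X‖ :=
      mul_le_mul_of_nonneg_right (mul_le_mul_of_nonneg_left h3 (by positivity)) (norm_nonneg X)
    refine this.trans (le_of_eq ?_)
    ring
  · rw [kerQdd_of_not_bondIn hnot, mul_zero, zero_mul] at h2
    exact norm_le_zero_iff.1 h2

include hL hθ hC'' hC₃ hb hadd hsmul h139 h145 hloc h148 hdiff h131 hρ h155 in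
/-- **(156) PER BOND, k-UNIFORM** «|(δ/δA_b)Q_k(U₀, ηA, c)| ≦ 1 + 2C′₁α₀ + C₃|A|»: `B′ ↦ Q_j(U₀, ηB′)(c)` (the composite (127),
`logCovIter`) is differentiable at `B` in the direction `X·δ_b` with derivative `dC_j(B; Xδ_b)(c) + LʲηQ_j(U₀)(Xδ_b)(c)`, of norm
`≤ ((1 + θs_j)·Lʲ + C₃(Lʲ)²b)·L^{−jd}·‖X‖` — (147) + (157) via (134). [cite: Balaban1985Averaging, Prop. 5 (156) p.42, (134) p.38, (147) p.40] -/
theorem prop5_156 (y : Site d) (μ : Fin d) (X : 𝔸) {j : ℕ} (hj : j ≤ k) (z : Site d) (κ : Fin d) :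
    HasLineDerivAt ℂ (fun B' => logCovIter L U₀ B' j z κ)
        (dCov L U₀ B (bump y μ X) j z κ + linCovIter L U₀ (bump y μ X) j z κ) B (bump y μ X) ∧
      ‖dCov L U₀ B (bump y μ X) j z κ + linCovIter L U₀ (bump y μ X) j z κ‖ ≤
        ((1 + θ * ((L : ℝ) ^ j * ((L : ℝ) ^ k)⁻¹) ^ 2) * (L : ℝ) ^ j + C₃ * ((L : ℝ) ^ j) ^ 2 * b)
          * (((L : ℝ) ^ j) ^ d)⁻¹ * ‖X‖ := by
  obtain ⟨h1, h2, -⟩ :=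
    prop5_157 L hL U₀ k hθ hC'' hC₃ hb hadd hsmul h139 h145 hloc h148 hdiff B h131 hρ h155 y μ X hj z κ
  have h3 := ineq147 L hL U₀ k hθ h139 h145 y μ X hj z κ
  refine ⟨?_, (norm_add_le _ _).trans ?_⟩
  · have h1' : HasDerivAt (fun t : ℂ => CCovIter L U₀ (B + t • bump y μ X) j z κ) (dCov L U₀ B (bump y μ X) j z κ) 0 := h1
    have h12 := h1'.add (hasDerivAt_linCovIter_line L U₀ k hadd hsmul B (bump y μ X) hj z κ)
    show HasDerivAt (fun t : ℂ => logCovIter L U₀ (B + t • bump y μ X) j z κ) _ 0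
    refine h12.congr_of_eventuallyEq (Filter.Eventually.of_forall fun t => ?_)
    simp [CCovIter]
  · refine (add_le_add h2 h3).trans (le_of_eq ?_)
    ring

end Levels

end Literature.MathematicalPhysics.QuantumFieldTheory.Balaban1983to89.B7Prop5GeneralInduction

end
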